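import Literature.MathematicalPhysics.QuantumFieldTheory.Balaban1983to89.T4HistoryLipschitzRecursion
import Literature.MathematicalPhysics.QuantumFieldTheory.Balaban1983to89.T4BetaReadOutLipschitz

/-!
# NE9MarginalProjection — the history channel of the NE9 frame must be fed MARGINAL-FREE old terms: the read-out
projection `P H = H − r(H)·A`, the composition theorems for `𝒯 ∘ P`, the END at `T := 𝒯 ∘ P`, and a necessity toy
(skeleton `t4/b2b-balaban-t4-ne9-p1/SKELETON-NE9-P1.md` v1.3, leaf S5 / open statement O-NE9-2; cell `pub-balaban`, T4-DAG §2
node U3 / §6 NE9; lineage t4-ne9-p1 = prover P1, generation 22; co-owner P3's `t4/skeletons/NE9-t4-ne9-p3.md` L5b/L5c)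

HONEST FRAMING (T4-DAG PAGE 1).  Rung (B)+1 on a FIXED finite torus with `FlowStep.BetaPertH` and (B) explicit — NOT infinite
volume, NOT a mass gap, NOT the Clay problem.  NE9 is a cell NEW ESTIMATE, NOT PRINTED, NOT discharged here: bookkeeping over the
ABSTRACT carriers; every analytic input a DISPLAYED binder; [I] = [Balaban1987RG1], [II] = [Balaban1988RG2Cluster] quoted for
TYPES/STRUCTURE only (ABSOLUTE RULE).  BetaPertH, (B), (B^μ) do not occur.  0/9 unchanged.

WHY (a located correction of the frame's DICTIONARY, not of any landed theorem).  The sibling lineage P2's per-creation-step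
size binder `T4HistoryLipschitzRecursion.ChannelSizeAtStepNN Adm T κ wt τ` with `τ k j ≤ τ̄·ω^{k−j}`, `ω = L⁻¹`, is the SOURCE of
the fading memory (`fade_iff`).  Its printed support is [II] p. 8 l. 9–10 *"To bound the first sum, over □′ ⊂ □̃², we use the
factor (L^jη)⁵ in (1.24). This yields (6L)⁴L^jη, and the sum over j is bounded by 2(6L)⁴."* and p. 9 *"The first term under
the exponential gives also the factor L^jη, which controls the sum over j"*.  Those factors come from the mechanism of [I]
p. 258: *"we expand the last expression in 𝐇 up to the fifth order. The fifth order term can be bounded by E₀O((L^jη)⁵)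
exp(−κd_j(X)). The sum of lower order terms is analyzed with a help of Ward-Takahashi identities. They allow the extraction
of terms, which grouped together yield an expansion of βA^η(exp iη𝐇). The remaining terms have bounds as above. We define the
function β_j(g_{j−1}) to be equal to the coefficient β. Thus we obtain* `−β_j(g_{j−1})A^η(U_k) + 𝐄^{(j)}(U_k) = Σ_{X∈𝐃_j}
𝐕^{(j)}(X, U_k)` (0.28), *where the functions 𝐕^{(j)} satisfy the inequalities* `|𝐕^{(j)}(X, U_k)| ≦ O(1)(L^jη)^{4+α}
exp(−κd_j(X)), α > 0` (0.29)" — i.e. the gain `L^jη` is a property of the MARGINAL-FREE package «term + its coupling-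
renormalization counterterm», and the old action that enters the fluctuation integral (2.10) p. 267 / the curly bracket of
(2.12) p. 268 IS packaged so, scale by scale: (1.3) p. 260 *"A_k(U_k) = −(1/g_k²)A(U_k) + Σ_{j=0}^{k−1}{−β_{j+1}(g_j)A(U_k) +
[log Z^{(j)}(U_k) − log Z^{(j)}(1)] + [𝐄^{(j+1)}(g_j, U_k) − 𝐄^{(j+k)}(g_j, 1)]}"*.  The cell's term family `E g U X` is the
COUNTERTERM-FREE one — node U2 reads β FROM it by the LINEAR recipe (1.20)–(1.22) p. 264 (`T4BetaReadOut.RepresentsA`).  Hence: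
* on the admissible class S2 = «all families analytic on the inductive domains» the per-step fading bound is FALSE for
  Bałaban's localized curly bracket — WITNESS: `H := c·A_□` on the single cubes □ of the scale j (analytic, gauge invariant,
  bounded, `d_j(□) = 0`) has curly bracket `c·Σ_□[A_□(U(B′)) − A_□(U)] = c·[A(U(B′)) − A(U)]`, the main fluctuation quadratic
  form, the SAME for every j ≤ k — no factor `L^{−(k−j)}`; summed over j ≤ k it grows like k (the logarithmic coupling-constant
  renormalization itself).  Kernel shadow: `NE9MarginalProjectionEnd.not_fading_on_full_class`.
* the REPAIR is a dictionary line, not an estimate: the channel of the frame is `T := 𝒯 ∘ P`, `𝒯` = the localized curly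
  bracket on MARGINAL-FREE inputs (where [I] p. 258 / [II] pp. 7–9 give the gain), `P H := H − Σ_j r_j(H_j)·A_□` the
  projection re-attaching the counterterm through the linear read-out `r` = node U2's `T4BetaReadOut.ReadOut` (bound (R) =
  `T4BetaReadOutLipschitz.ReadBoundedOn`, constant `cr`, BY NAME §3).  For `H = E g` the projected family IS the package of (1.3).
  Cost: the channel weight grows by the factor `1 + cr·a`, `a` = a uniform bound of the one-cube Wilson action on the complex
  domains (elementary); the fading condition (leaf N2) reads `ω + 8·lipbar·B·(1 + cr·a)·τ̄ < 1` (§4).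
Co-owner P3 (`t4/skeletons/NE9-t4-ne9-p3.md` L5b «β-SLAVING … the RENORMALISED family [−R(∂𝐄^{(m)})A^η + ∂𝐄^{(m)}], marginal-free
BY LINEARITY of (1.20)–(1.22)», L5c «a marginal-free admissible family … one factor ω per step of age») reads S5 this way; this
module is the kernel junction that lets the owner's DAG say so.

WHAT IS PROVED (kernel, `[folklore]` bookkeeping; nothing about [I]/[II] asserted).
§1 `compProj 𝒯 P` and binders `ProjAdditive`/`ProjScaleComm`/`ProjInto`/`ProjSize`; the three channel binders of the frame for
   `𝒯 ∘ P` on `Adm` from the same binders for `𝒯` on the image class `MF` (`channelAdditive_compProj`, `channelStepSum_compProj`,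
   `channelSizeAtStepNN_compProj` — weight `(1 + c)·τ`).
§2 the read-out projection `margProj r A` and its three properties from `ReadAdditive`, `ReadZero`, `ReadSize` (cr), `DirSize` (a).
§3 adapter: `ReadSize` for the scale-indexed shift of a `T4BetaReadOut.ReadOut` from `ReadBoundedOn` (node U2's (R), BY NAME).
§4 N2 scalars: `rate_lt_one_of_smallness`, `rate_lt_one_letters` (ω = L⁻¹, L ≥ 2).
Sibling `NE9MarginalProjectionEnd`: the END of the lineage at `T := 𝒯 ∘ P` (g21's `…_vacSub_sizeInduction` re-run) and the
necessity toy (a step-sum additive channel fading on the marginal-free class and on NO geometric profile on the full class).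

References (TYPES/STRUCTURE only): [Balaban1987RG1] CMP 109 (1987) (0.22)–(0.23) p. 256, (0.28)–(0.30) p. 258, (1.3) p. 260,
(1.18) p. 263, (1.20)–(1.22) p. 264, (2.10) p. 267, (2.12)–(2.15) p. 268; [Balaban1988RG2Cluster] CMP 116 (1988) (1.24) p. 7,
p. 8 l. 9–10, (1.33)–(1.36) p. 9.
-/

noncomputable section

namespace Summit.QuantumFields.BalabanUV.T4Continuum.NE9MarginalProjection

open scoped BigOperators
open Literature.MathematicalPhysics.QuantumFieldTheory.Balaban1983to89
open Literature.MathematicalPhysics.QuantumFieldTheory.Balaban1983to89.T4OutputRate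
open Literature.MathematicalPhysics.QuantumFieldTheory.Balaban1983to89.T4HistoryLipschitzRecursion

variable {C : Carriers} {Bg ι : Type}

/-! ## §1 A channel composed with a projection of the old terms -/

/-- The channel `𝒯` fed with the PROJECTED old terms: `(𝒯 ∘ P) k s H := 𝒯 k s (P H)` — dictionary: `𝒯` = the localized curly
bracket (1.33) p. 9 of [II] on marginal-free inputs, `P` = re-attachment of the counterterm of (1.3) p. 260 of [I].
[cite: Balaban1987RG1, (1.3) p.260; Balaban1988RG2Cluster, (1.33) p.9] -/
def compProj (𝒯 : ℕ → (ℕ → ℝ) → (Bg → C.Dom → ℝ) → ι → ℝ) (P : (Bg → C.Dom → ℝ) → (Bg → C.Dom → ℝ)) :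
    ℕ → (ℕ → ℝ) → (Bg → C.Dom → ℝ) → ι → ℝ :=
  fun k s H y => 𝒯 k s (P H) y

/-- BINDER: the projection is additive on the admissible class (the read-out (1.20)–(1.22) p. 264 of [I] is LINEAR in the term
family). [cite: Balaban1987RG1, (1.20)-(1.22) p.264] -/
def ProjAdditive (Adm : Set (Bg → C.Dom → ℝ)) (P : (Bg → C.Dom → ℝ) → (Bg → C.Dom → ℝ)) : Prop :=
  ∀ H₁ ∈ Adm, ∀ H₂ ∈ Adm, P (H₁ - H₂) = P H₁ - P H₂

/-- BINDER: the projection acts creation step by creation step ((1.3) p. 260 of [I]: one counterterm `−β_{j+1}(g_j)A` per step).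
[cite: Balaban1987RG1, (1.3) p.260] -/
def ProjScaleComm (Adm : Set (Bg → C.Dom → ℝ)) (P : (Bg → C.Dom → ℝ) → (Bg → C.Dom → ℝ)) : Prop :=
  ∀ H ∈ Adm, ∀ j : ℕ, P (restrictScale j H) = restrictScale j (P H)

/-- BINDER: the projection maps the admissible class into the marginal-free class `MF` ((0.28) p. 258 of [I]: the package
`−β_jA^η + 𝐄^{(j)}` is a sum of irrelevant terms). [cite: Balaban1987RG1, (0.28)-(0.29) p.258] -/
def ProjInto (Adm MF : Set (Bg → C.Dom → ℝ)) (P : (Bg → C.Dom → ℝ) → (Bg → C.Dom → ℝ)) : Prop :=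
  ∀ H ∈ Adm, P H ∈ MF

/-- BINDER: the projection costs at most the factor `1 + c` in the `e^{−κd}·N` currency of (1.18) p. 263 of [I], step by step,
and preserves the creation-step support. [cite: Balaban1987RG1, (1.18) p.263] -/
def ProjSize (Adm : Set (Bg → C.Dom → ℝ)) (P : (Bg → C.Dom → ℝ) → (Bg → C.Dom → ℝ)) (κ c : ℝ) : Prop :=
  ∀ (j : ℕ), ∀ H ∈ Adm, (∀ (U : Bg) (X : C.Dom), C.scale X ≠ j → H U X = 0) →
    ∀ N : ℝ, 0 ≤ N → (∀ (U : Bg) (X : C.Dom), C.scale X = j → |H U X| ≤ Real.exp (-(κ * C.d X)) * N) →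
      ∀ (U : Bg) (X : C.Dom), C.scale X = j → |P H U X| ≤ Real.exp (-(κ * C.d X)) * ((1 + c) * N)

/-- A family supported on one creation step is its own restriction to that step. [folklore] -/
theorem restrictScale_eq_self_of_supported {j : ℕ} {H : Bg → C.Dom → ℝ}
    (hsupp : ∀ (U : Bg) (X : C.Dom), C.scale X ≠ j → H U X = 0) : restrictScale j H = H := by
  funext U X
  by_cases hX : C.scale X = j
  · exact restrictScale_of_eq H hX
  · rw [restrictScale_of_ne H hX, hsupp U X hX]

/-- Restricting twice to the same step is restricting once. [folklore] -/
theorem restrictScale_restrictScale_self (j : ℕ) (H : Bg → C.Dom → ℝ) :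
    restrictScale j (restrictScale j H) = restrictScale j H := by
  funext U X
  by_cases hX : C.scale X = j
  · rw [restrictScale_of_eq _ hX]
  · rw [restrictScale_of_ne _ hX, restrictScale_of_ne _ hX]

/-- Restrictions to two different steps compose to zero. [folklore] -/
theorem restrictScale_restrictScale_of_ne {i j : ℕ} (h : i ≠ j) (H : Bg → C.Dom → ℝ) :
    restrictScale i (restrictScale j H) = 0 := by
  funext U X
  by_cases hX : C.scale X = i
  · rw [restrictScale_of_eq _ hX, restrictScale_of_ne _ (fun hj => h (hX.symm.trans hj))]
    rfl
  · rw [restrictScale_of_ne _ hX]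
    rfl

/-- Restriction to a step is additive. [folklore] -/
theorem restrictScale_sub (j : ℕ) (H₁ H₂ : Bg → C.Dom → ℝ) :
    restrictScale j (H₁ - H₂) = restrictScale j H₁ - restrictScale j H₂ := by
  funext U X
  by_cases hX : C.scale X = j
  · rw [Pi.sub_apply, Pi.sub_apply, restrictScale_of_eq _ hX, restrictScale_of_eq _ hX, restrictScale_of_eq _ hX,
      Pi.sub_apply, Pi.sub_apply]
  · rw [Pi.sub_apply, Pi.sub_apply, restrictScale_of_ne _ hX, restrictScale_of_ne _ hX, restrictScale_of_ne _ hX, sub_zero]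

/-- A projected family supported on one step stays supported there (scale-commutation). [folklore] -/
theorem compProj_supported {Adm : Set (Bg → C.Dom → ℝ)} {P : (Bg → C.Dom → ℝ) → (Bg → C.Dom → ℝ)}
    (hcomm : ProjScaleComm Adm P) {j : ℕ} {H : Bg → C.Dom → ℝ} (hH : H ∈ Adm)
    (hsupp : ∀ (U : Bg) (X : C.Dom), C.scale X ≠ j → H U X = 0) :
    ∀ (U : Bg) (X : C.Dom), C.scale X ≠ j → P H U X = 0 := by
  intro U X hX
  have h := hcomm H hH j
  rw [restrictScale_eq_self_of_supported hsupp] at h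
  rw [h, restrictScale_of_ne _ hX]

/-- **S3 FOR `𝒯 ∘ P`**: additivity of the composed channel on `Adm` from additivity of `𝒯` on the image class.
[folklore] -/
theorem channelAdditive_compProj {Adm MF : Set (Bg → C.Dom → ℝ)} {P : (Bg → C.Dom → ℝ) → (Bg → C.Dom → ℝ)}
    {𝒯 : ℕ → (ℕ → ℝ) → (Bg → C.Dom → ℝ) → ι → ℝ} (hP : ProjAdditive Adm P) (hinto : ProjInto Adm MF P)
    (hadd : ChannelAdditive MF 𝒯) : ChannelAdditive Adm (compProj 𝒯 P) := by
  intro k s H₁ h₁ H₂ h₂ y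
  show 𝒯 k s (P (H₁ - H₂)) y = 𝒯 k s (P H₁) y - 𝒯 k s (P H₂) y
  rw [hP H₁ h₁ H₂ h₂]
  exact hadd k s (P H₁) (hinto H₁ h₁) (P H₂) (hinto H₂ h₂) y

/-- **S3 (STEP SUM) FOR `𝒯 ∘ P`**: the composed channel sums over the creation steps on `Adm` if `𝒯` does on the image class
and `P` acts step by step. [folklore] -/
theorem channelStepSum_compProj {Adm MF : Set (Bg → C.Dom → ℝ)} {P : (Bg → C.Dom → ℝ) → (Bg → C.Dom → ℝ)}
    {𝒯 : ℕ → (ℕ → ℝ) → (Bg → C.Dom → ℝ) → ι → ℝ} (hcomm : ProjScaleComm Adm P) (hinto : ProjInto Adm MF P)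
    (hsum : ChannelStepSum MF 𝒯) : ChannelStepSum Adm (compProj 𝒯 P) := by
  intro k s H hH y
  show 𝒯 k s (P H) y = ∑ j ∈ Finset.range (k + 1), 𝒯 k s (P (restrictScale j H)) y
  rw [hsum k s (P H) (hinto H hH) y]
  exact Finset.sum_congr rfl fun j _ => by rw [hcomm H hH j]

/-- **S5 FOR `𝒯 ∘ P`**: the per-creation-step size bound of the composed channel on `Adm`, with the weights `(1 + c)·τ`, from
the per-step bound of `𝒯` on the MARGINAL-FREE image class and the projection's size.  This is the corrected reading of leaf S5:
the printed gain `L^jη` ([II] p. 8 l. 9–10) is claimed for marginal-free inputs only.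
[cite: Balaban1988RG2Cluster, p.8 l.9-10 and (1.36) p.9; Balaban1987RG1, (0.28)-(0.29) p.258] -/
theorem channelSizeAtStepNN_compProj {Adm MF : Set (Bg → C.Dom → ℝ)} {P : (Bg → C.Dom → ℝ) → (Bg → C.Dom → ℝ)}
    {𝒯 : ℕ → (ℕ → ℝ) → (Bg → C.Dom → ℝ) → ι → ℝ} {κ c : ℝ} {wt : ℕ → ι → ℝ} {τ : ℕ → ℕ → ℝ}
    (hcomm : ProjScaleComm Adm P) (hinto : ProjInto Adm MF P) (hsize : ProjSize Adm P κ c) (hc : 0 ≤ c)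
    (hstep : ChannelSizeAtStepNN MF 𝒯 κ wt τ) :
    ChannelSizeAtStepNN Adm (compProj 𝒯 P) κ wt (fun k j => (1 + c) * τ k j) := by
  intro k j hjk s H hH hsupp N hN hbound y
  show |𝒯 k s (P H) y| ≤ wt k y * ((1 + c) * τ k j * N)
  have hN' : 0 ≤ (1 + c) * N := mul_nonneg (by linarith) hN
  have h := hstep k j hjk s (P H) (hinto H hH) (compProj_supported hcomm hH hsupp) ((1 + c) * N) hN'
    (hsize j H hH hsupp N hN hbound) y
  calc |𝒯 k s (P H) y| ≤ wt k y * (τ k j * ((1 + c) * N)) := h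
    _ = wt k y * ((1 + c) * τ k j * N) := by ring

/-- The composed weights keep a geometric profile, with `τ̄ ↦ (1 + c)·τ̄`. [folklore] -/
theorem compWeights_profile {τ : ℕ → ℕ → ℝ} {τbar ω c : ℝ} (hc : 0 ≤ c)
    (hτ : ∀ k j, j ≤ k → 0 ≤ τ k j ∧ τ k j ≤ τbar * ω ^ (k - j)) :
    ∀ k j, j ≤ k → 0 ≤ (1 + c) * τ k j ∧ (1 + c) * τ k j ≤ (1 + c) * τbar * ω ^ (k - j) := by
  intro k j hjk
  obtain ⟨h0, h1⟩ := hτ k j hjk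
  refine ⟨mul_nonneg (by linarith) h0, ?_⟩
  rw [mul_assoc]
  exact mul_le_mul_of_nonneg_left h1 (by linarith)

/-! ## §2 The read-out projection `P H = H − r(H)·A` -/

/-- THE READ-OUT PROJECTION: subtract from the term family, on every domain, (the read-out of its own creation-step slice) ×
(the marginal direction `A`) — dictionary: `r j` = the recipe (1.20)–(1.22) p. 264 of [I] applied to the scale-j terms, `A U X`
= the Wilson action `A^η` of (1.3) p. 260 distributed over the single cubes of each scale (zero elsewhere); `margProj r A (E g)`
is then the scale-by-scale package `{−β_{j+1}(g_j)A + …}` of (1.3). [cite: Balaban1987RG1, (1.3) p.260 and (1.20)-(1.22) p.264] -/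
def margProj (r : ℕ → (Bg → C.Dom → ℝ) → ℝ) (A : Bg → C.Dom → ℝ) (H : Bg → C.Dom → ℝ) : Bg → C.Dom → ℝ :=
  fun U X => H U X - r (C.scale X) (restrictScale (C.scale X) H) * A U X

/-- BINDER: the step-j read-out is additive on the admissible slices (LINEARITY of (1.20)–(1.22): second variational derivative
at 0, sum over x, second moment). [cite: Balaban1987RG1, (1.20)-(1.22) p.264] -/
def ReadAdditive (Adm : Set (Bg → C.Dom → ℝ)) (r : ℕ → (Bg → C.Dom → ℝ) → ℝ) : Prop :=
  ∀ j, ∀ H₁ ∈ Adm, ∀ H₂ ∈ Adm,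
    r j (restrictScale j (H₁ - H₂)) = r j (restrictScale j H₁) - r j (restrictScale j H₂)

/-- BINDER: the read-out of the zero family vanishes. [folklore] -/
def ReadZero (r : ℕ → (Bg → C.Dom → ℝ) → ℝ) : Prop :=
  ∀ j, r j 0 = 0

/-- BINDER (node U2's (R) in the per-step currency): a scale-j family of size `N·e^{−κd}` has read-out at most `cr·N` — the
shape `T4BetaReadOut.ReadBounded` / `T4BetaReadOutLipschitz.ReadBoundedOn` against the zero family (§3); `cr` is NOT PRINTED
(cell GAPS C-ne4p1-7). [cite: Balaban1987RG1, (1.18) p.263 and (1.20)-(1.22) p.264] -/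
def ReadSize (Adm : Set (Bg → C.Dom → ℝ)) (r : ℕ → (Bg → C.Dom → ℝ) → ℝ) (κ cr : ℝ) : Prop :=
  ∀ j, ∀ H ∈ Adm, ∀ N : ℝ, 0 ≤ N →
    (∀ (U : Bg) (X : C.Dom), C.scale X = j → |H U X| ≤ Real.exp (-(κ * C.d X)) * N) → |r j (restrictScale j H)| ≤ cr * N

/-- BINDER: the marginal direction is of size `a` in the `e^{−κd}` currency (for the one-cube Wilson action: the cubes have
tree length 0 and `A_□` is bounded uniformly on the complex domains 𝔘^c_j(□, α₀, α₁) of p. 262–263 of [I]; elementary).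
[cite: Balaban1987RG1, (1.11)-(1.14) p.262 and (1.18) p.263] -/
def DirSize (A : Bg → C.Dom → ℝ) (κ a : ℝ) : Prop :=
  ∀ (U : Bg) (X : C.Dom), |A U X| ≤ a * Real.exp (-(κ * C.d X))

/-- The read-out projection is additive on the admissible class. [folklore] -/
theorem projAdditive_margProj {Adm : Set (Bg → C.Dom → ℝ)} {r : ℕ → (Bg → C.Dom → ℝ) → ℝ} (A : Bg → C.Dom → ℝ)
    (hr : ReadAdditive Adm r) : ProjAdditive Adm (margProj r A) := by
  intro H₁ h₁ H₂ h₂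
  funext U X
  simp only [margProj, Pi.sub_apply]
  rw [hr (C.scale X) H₁ h₁ H₂ h₂]
  ring

/-- The read-out projection acts creation step by creation step (on every family). [folklore] -/
theorem projScaleComm_margProj (Adm : Set (Bg → C.Dom → ℝ)) {r : ℕ → (Bg → C.Dom → ℝ) → ℝ} (A : Bg → C.Dom → ℝ)
    (h0 : ReadZero r) : ProjScaleComm Adm (margProj r A) := by
  intro H _ j
  funext U X
  by_cases hX : C.scale X = j
  · rw [restrictScale_of_eq _ hX]
    simp only [margProj]
    rw [restrictScale_of_eq _ hX, hX, restrictScale_restrictScale_self]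
  · rw [restrictScale_of_ne _ hX]
    simp only [margProj]
    rw [restrictScale_of_ne _ hX, restrictScale_restrictScale_of_ne hX, h0, zero_mul, sub_zero]

/-- The read-out projection costs the factor `1 + cr·a` and keeps the support. [folklore] -/
theorem projSize_margProj {Adm : Set (Bg → C.Dom → ℝ)} {r : ℕ → (Bg → C.Dom → ℝ) → ℝ} {A : Bg → C.Dom → ℝ} {κ cr a : ℝ}
    (hrs : ReadSize Adm r κ cr) (hA : DirSize A κ a) (hcr : 0 ≤ cr) :
    ProjSize Adm (margProj r A) κ (cr * a) := by
  intro j H hH _ N hN hbound U X hX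
  have hr : |r j (restrictScale j H)| ≤ cr * N := hrs j H hH N hN hbound
  have hHX := hbound U X hX
  have hAX := hA U X
  have hexp : 0 ≤ Real.exp (-(κ * C.d X)) := (Real.exp_pos _).le
  simp only [margProj]
  rw [hX]
  calc |H U X - r j (restrictScale j H) * A U X|
      ≤ |H U X| + |r j (restrictScale j H) * A U X| := abs_sub _ _
    _ = |H U X| + |r j (restrictScale j H)| * |A U X| := by rw [abs_mul]
    _ ≤ Real.exp (-(κ * C.d X)) * N + cr * N * (a * Real.exp (-(κ * C.d X))) :=
        add_le_add hHX (mul_le_mul hr hAX (abs_nonneg _) (mul_nonneg hcr hN))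
    _ = Real.exp (-(κ * C.d X)) * ((1 + cr * a) * N) := by ring

/-! ## §3 Adapter: the per-step read-out bound from node U2's (R) `ReadBoundedOn` -/

/-- The scale-indexed shift of node U2's read-out: `r (k+1) := r₀ k` reads the scale-(k+1) slice ((1.20)–(1.22): β_{j+1} is
read from the scale-(j+1) terms); nothing is read at scale 0 ((0.23) p. 256: no term is created there).
[cite: Balaban1987RG1, (0.23) p.256 and (1.20)-(1.22) p.264] -/
def shiftRead (r₀ : T4BetaReadOut.ReadOut C Bg) : ℕ → (Bg → C.Dom → ℝ) → ℝ :=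
  fun j H => if j = 0 then 0 else r₀ (j - 1) H

/-- The shifted read-out of the zero family vanishes if node U2's does. [folklore] -/
theorem readZero_shiftRead {r₀ : T4BetaReadOut.ReadOut C Bg} (hr0 : ∀ k, r₀ k 0 = 0) : ReadZero (shiftRead r₀) := by
  intro j
  by_cases hj : j = 0 <;> simp [shiftRead, hj, hr0]

/-- Additivity transfers to the shifted read-out. [folklore] -/
theorem readAdditive_shiftRead {Adm : Set (Bg → C.Dom → ℝ)} {r₀ : T4BetaReadOut.ReadOut C Bg}
    (hadd : ∀ k, ∀ H₁ ∈ Adm, ∀ H₂ ∈ Adm, r₀ k (restrictScale (k + 1) (H₁ - H₂)) =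
      r₀ k (restrictScale (k + 1) H₁) - r₀ k (restrictScale (k + 1) H₂)) :
    ReadAdditive Adm (shiftRead r₀) := by
  intro j H₁ h₁ H₂ h₂
  by_cases hj : j = 0
  · simp [shiftRead, hj]
  · obtain ⟨k, rfl⟩ := Nat.exists_eq_succ_of_ne_zero hj
    simp only [shiftRead, Nat.succ_ne_zero, if_false, Nat.succ_sub_one]
    exact hadd k H₁ h₁ H₂ h₂

/-- **(R) ⇒ THE PER-STEP READ-OUT BOUND** (junction BY NAME with node U2): `ReadBoundedOn 𝒜 r₀ κ cr` on a class containing the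
zero slice and the step restrictions of the admissible families gives `ReadSize Adm (shiftRead r₀) κ cr`.
[cite: Balaban1987RG1, (1.18) p.263 and (1.20)-(1.22) p.264] -/
theorem readSize_of_readBoundedOn {Adm : Set (Bg → C.Dom → ℝ)} {𝒜 : Set (T4BetaReadOut.Slice C Bg)}
    {r₀ : T4BetaReadOut.ReadOut C Bg} {κ cr : ℝ} (hR : T4BetaReadOutLipschitz.ReadBoundedOn 𝒜 r₀ κ cr)
    (h0mem : (0 : Bg → C.Dom → ℝ) ∈ 𝒜) (hres : ∀ H ∈ Adm, ∀ j, restrictScale j H ∈ 𝒜) (hr0 : ∀ k, r₀ k 0 = 0)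
    (hcr : 0 ≤ cr) : ReadSize Adm (shiftRead r₀) κ cr := by
  intro j H hH N hN hbound
  by_cases hj : j = 0
  · simp only [shiftRead, hj, if_true, abs_zero]
    exact mul_nonneg hcr hN
  · obtain ⟨k, rfl⟩ := Nat.exists_eq_succ_of_ne_zero hj
    simp only [shiftRead, Nat.succ_ne_zero, if_false, Nat.succ_sub_one]
    have hclose : T4BetaReadOut.SliceClose κ k (restrictScale (k + 1) H) (0 : Bg → C.Dom → ℝ) N := by
      intro U X hX
      rw [Pi.zero_apply, Pi.zero_apply, sub_zero, restrictScale_of_eq _ hX, mul_comm]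
      exact hbound U X hX
    have h := hR k _ _ N (hres H hH (k + 1)) h0mem hclose
    rwa [hr0 k, sub_zero] at h

/-! ## §4 Leaf N2 with the corrected constant -/

/-- **N2 (scalar)**: the memory FADES (`rate < 1`) as soon as the feedback gain `8·lipbar·B·(1 + c)·τ̄` is at most half the
margin `1 − ω` — inside «ε₁ sufficiently small» the gain carries ε₁² ((1.36) p. 9 × (2.38) p. 20 of [II]); the INEQUALITY is
ours (cell `SMALLNESS.md`), only its letters are printed. [cite: Balaban1988RG2Cluster, (1.36) p.9 and (2.38) p.20] -/
theorem rate_lt_one_of_smallness {ω lipbar B τbar c : ℝ} (hω : ω < 1)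
    (h : 8 * lipbar * B * ((1 + c) * τbar) ≤ (1 - ω) / 2) : ω + 8 * lipbar * B * ((1 + c) * τbar) < 1 := by
  linarith

/-- **N2 at the printed letter `ω = L⁻¹`** ([II] p. 8: one factor `L^jη = L^{−(k−j)}` per step of age), block size `L ≥ 2`:
a feedback gain `≤ 1/4` fades. [cite: Balaban1988RG2Cluster, p.8 l.9-10] -/
theorem rate_lt_one_letters {L lipbar B τbar c : ℝ} (hL : 2 ≤ L)
    (h : 8 * lipbar * B * ((1 + c) * τbar) ≤ 1 / 4) : 1 / L + 8 * lipbar * B * ((1 + c) * τbar) < 1 := by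
  have hL0 : 0 < L := by linarith
  have h1 : 1 / L ≤ 1 / 2 := by
    rw [div_le_div_iff₀ hL0 two_pos]
    linarith
  linarith

end Summit.QuantumFields.BalabanUV.T4Continuum.NE9MarginalProjection

end
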